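import Mathlib
import Summits.Ventures.HodgeRepro.Tier4.Target
import Summits.Ventures.HodgeRepro.Tier4.Line3.KMDatum
import Summits.Ventures.HodgeRepro.Tier4.Line3.KMDatumS
import Summits.Ventures.HodgeRepro.Tier4.Line3.Defs
import Summits.Ventures.HodgeRepro.Tier4.Line3.HeckeEquivarianceLemmas
import Summits.Ventures.HodgeRepro.Tier4.Line3.WittRank3
import Summits.Ventures.HodgeRepro.Tier4.Line3.CentreFibres

/-!
# Tier4/Line3/CentreFinite — the scalars of a congruence subgroup are finitely many (L3.6a, R-c for the centre)

Blind re-derivation cell `pub-hodge-repro`, Tier 4 «PROVE THE STEP» (README §9–§10), LINE L3, seat t4-L3-p1 (prover);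
support (R-c, centre half, of proofs/t4/L3/L36a-support.md) of L3.6a `term_main_unfold` (lead S12253).

CONTENT.  A scalar `t • 1 ∈ Γ′` has `t` an algebraic integer (`IsIntegralMatrix`, from `Γ′ ⊆ Γ(1)`) with `c(t) t = 1`
(unitary for the non-zero `H`), so every complex embedding has `‖φ t‖ = 1` (the CM conjugation intertwines with `conj`:
`NumberField.IsCMField.complexEmbedding_complexConj`).  Such `t` are finitely many (Kronecker's bound,
`NumberField.Embeddings.finite_of_norm_le` with `B = 1`), and `γ ↦ γ 0 0` is injective on the scalars: hence
`Finite (Centre K)` (`finite_centre`) and `centerCard K ≠ 0` (`centerCard_ne_zero`, since `1 ∈ Γ′` is a scalar).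

Nothing here asserts anything about the truth of (P); HC_CM is NOT proved by anyone in this repository.
-/

set_option autoImplicit false

noncomputable section

namespace Summit.Ventures.HodgeRepro.Tier4.Line3

open Summit.Ventures.HodgeRepro.Tier4
open Matrix
open scoped ComplexConjugate
open HeckeEquivariance

/-- `cstar` of a scalar matrix is the conjugate scalar matrix. -/
theorem cstar_smul_one {E : Type*} [Field E] (c : E ≃+* E) (t : E) :
    cstar c (t • (1 : Matrix (Fin 3) (Fin 3) E)) = c t • (1 : Matrix (Fin 3) (Fin 3) E) := by
  ext i j
  simp only [cstar, Matrix.transpose_apply, Matrix.map_apply, Matrix.smul_apply, Matrix.one_apply, smul_eq_mul]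
  by_cases h : i = j
  · subst h; simp
  · simp [h, Ne.symm h]

/-- A scalar `t • 1` unitary for a non-zero `H` has `c(t) t = 1`. -/
theorem conj_mul_self_eq_one_of_isUnitaryOf_smul_one {E : Type*} [Field E] (c : E ≃+* E)
    {H : Matrix (Fin 3) (Fin 3) E} (hH : H ≠ 0) {t : E} (h : IsUnitaryOf c H (t • (1 : Matrix (Fin 3) (Fin 3) E))) :
    c t * t = 1 := by
  unfold IsUnitaryOf at h
  rw [cstar_smul_one, Matrix.smul_mul, Matrix.one_mul, Matrix.mul_smul, Matrix.mul_one, smul_smul,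
    mul_comm t (c t)] at h
  by_contra hne
  have h' : (c t * t - 1) • H = 0 := by rw [sub_smul, one_smul, h, sub_self]
  rcases smul_eq_zero.mp h' with h0 | h0
  · exact hne (sub_eq_zero.mp h0)
  · exact hH h0

namespace T4Data

variable (X : T4Data)

/-- `H ≠ 0` (it is a unit, `V` being anisotropic). -/
theorem H_ne_zero : X.H ≠ 0 := by
  intro h0
  have := isUnit_H X
  rw [h0] at this
  exact not_isUnit_zero this

/-- Every complex embedding of a norm-one element of `E′` has absolute value `1`. -/
theorem norm_embedding_eq_one {t : X.E} (ht : X.c t * t = 1) (φ : X.E →+* ℂ) : ‖φ t‖ = 1 := by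
  have h1 : φ (X.c t) = conj (φ t) := NumberField.IsCMField.complexEmbedding_complexConj X.E φ t
  have h2 : φ t * conj (φ t) = 1 := by rw [← h1, ← map_mul, mul_comm, ht, map_one]
  rw [Complex.mul_conj'] at h2
  have h3 : ‖φ t‖ ^ 2 = 1 := by exact_mod_cast h2
  exact (pow_eq_one_iff_of_nonneg (norm_nonneg _) two_ne_zero).mp h3

/-- The scalar of an element of the centre, as an element of Kronecker's finite set. -/
theorem centre_scalar_mem (K : X.Level) (γ : X.Centre K) :
    γ.1 0 0 ∈ {x : X.E | IsIntegral ℤ x ∧ ∀ φ : X.E →+* ℂ, ‖φ x‖ ≤ 1} := by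
  obtain ⟨hγ, t, ht⟩ := γ.2
  have hint : IsIntegral ℤ (γ.1 0 0) := (K.2.1.2.2.2.1 hγ).2.1 0 0
  have hu : IsUnitaryOf X.c X.H γ.1 := isUnitaryOf_of_mem_level X K hγ
  have h00 : γ.1 0 0 = t := by rw [ht]; simp
  refine ⟨hint, fun φ => ?_⟩
  rw [h00] at hint ⊢
  rw [ht] at hu
  exact le_of_eq (X.norm_embedding_eq_one (conj_mul_self_eq_one_of_isUnitaryOf_smul_one X.c X.H_ne_zero hu) φ)

/-- `γ ↦ γ 0 0` is injective on the centre. -/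
theorem centre_scalar_injective (K : X.Level) : Function.Injective fun γ : X.Centre K => γ.1 0 0 := by
  intro γ γ' h
  obtain ⟨_, t, ht⟩ := γ.2
  obtain ⟨_, t', ht'⟩ := γ'.2
  have e : t = t' := by
    have h1 : γ.1 0 0 = t := by rw [ht]; simp
    have h2 : γ'.1 0 0 = t' := by rw [ht']; simp
    rw [← h1, ← h2]; exact h
  apply Subtype.ext
  rw [ht, ht', e]

/-- **THE CENTRE OF A CONGRUENCE SUBGROUP IS FINITE** (Kronecker). -/
theorem finite_centre (K : X.Level) : Finite (X.Centre K) := by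
  have hfin : Finite {x : X.E // x ∈ {x : X.E | IsIntegral ℤ x ∧ ∀ φ : X.E →+* ℂ, ‖φ x‖ ≤ 1}} :=
    (NumberField.Embeddings.finite_of_norm_le X.E ℂ 1).to_subtype
  exact Finite.of_injective (fun γ : X.Centre K => (⟨γ.1 0 0, X.centre_scalar_mem K γ⟩ :
    {x : X.E // x ∈ {x : X.E | IsIntegral ℤ x ∧ ∀ φ : X.E →+* ℂ, ‖φ x‖ ≤ 1}}))
    (fun γ γ' h => X.centre_scalar_injective K (congrArg Subtype.val h))

/-- The centre is non-empty (`1 ∈ Γ′`), so `centerCard K ≠ 0`. -/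
theorem centerCard_ne_zero (K : X.Level) : X.centerCard K ≠ 0 := by
  haveI := X.finite_centre K
  have hne : Nonempty (X.Centre K) := ⟨⟨1, K.2.1.1, 1, by simp⟩⟩
  unfold T4Data.centerCard
  exact Nat.card_ne_zero.mpr ⟨hne, X.finite_centre K⟩

end T4Data

end Summit.Ventures.HodgeRepro.Tier4.Line3

end
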